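import Mathlib
import Summits.ValiantsHypothesis.ValiantsHypothesis.Theorems.RigidityForcesSymmetryRankRigidMinimalReprLaplaceRestrict
import Summits.ValiantsHypothesis.ValiantsHypothesis.Theorems.RigidityForcesSymmetryRankRigidMinimalReprLaplaceTriangular

/-!
# Contraction of a slot: Laplace optimality one order down bounds the terms that survive a killing covector
# (crux `RankRigidMinimalRepr`, stmt-ValiantsHypothesis-18034; frontier rung `LaplaceOptimalFive`, stmt-24813)

A HYBRID of the two tools of the programme — the dual covector (`…LaplaceDual.lean`) and the restriction to a sub-box
(`…LaplaceRestrict.lean`): CONTRACT one slot `i` of a split-rank-one decomposition of `P_{d+1}` against a covector `λ`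
(sum over the letter `c` at slot `i` with weight `λ_c`) and restrict the other slots to the letters `≠ a`, where `λ_a ≠ 0`.
Since `Σ_c λ_c [v[i ↦ c] injective] = λ_a · [v' injective]` on the sub-box, the result is a decomposition of `λ_a P_d`
whose terms are the contracted terms, across the restricted splits `{k : i.succAbove k ∈ S_t}`; the terms KILLED by `λ`
(a `u`-factor through slot `i` with `Σ_c λ_c u(v[i ↦ c]) ≡ 0`, or a `w`-factor likewise) disappear.

* `contract` — `LaplaceOptimal d` ⟹ for every decomposition of `P_{d+1}`, slot `i`, covector `λ` with `λ_a ≠ 0` and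
  set `K` of killed terms: `d! ≤ Σ_{t ∉ K} c_t! (d - c_t)!`, `c_t = |{k : i.succAbove k ∈ S_t}|`.
* `contract_five` — the normal-form corollary at `d + 1 = 5` with the landed `laplaceOptimal_four`: for slices
  `α_k(v_{i k}) W_k` and pair terms `u_t(v_{p t}, v_{q t}) w_t` summing to `P₅` and ANY slot `s` carrying fewer than five
  slices, `24 ≤ 6·#{k : i k ≠ s} + 6·#{t : s ∈ {p t, q t}} + 4·#{t : s ∉ {p t, q t}}` (a covector orthogonal to the slice
  vectors at `s` kills them; slices elsewhere and pairs through `s` become slices of `P₄`, weight `6`; pairs off `s` stay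
  pairs, weight `4`).
* `three_slices_contract` — contrapositive packaging: a labelled configuration violating the count admits no decomposition.

Consequence for the `a = 3` class of `LaplaceOptimal 5` (closing file `…LaplaceFiveAtMostTwoSlices.lean`): every
configuration with the three slices on one slot, and every `(x,x,y)` configuration whose pairs do not all pass through `x`,
is impossible — 13 of the 17 configurations left by the certificate engines.  No definitions.  HONEST FRAMING: exact partial
results toward the frontier rung `LaplaceOptimalFive` (stmt-24813), which stays OPEN; nothing here bears on `VP ≠ VNP`.
-/

set_option autoImplicit false

-- the mandated summit-side namespace repeats a component by design (single-problem summit)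
set_option linter.dupNamespace false

namespace Summit.ValiantsHypothesis.ValiantsHypothesis.Theorems.RigidityForcesSymmetryRankRigidMinimalRepr

namespace LaplaceContract

open Finset

variable {d : ℕ}

/-! ### §1 The embedding with a free letter at the contracted slot -/

/-- Value at the contracted slot. -/
theorem emb_apply_same (i a c : Fin (d + 1)) (v : Fin d → Fin d) :
    (i.insertNth c (fun k => a.succAbove (v k)) : Fin (d + 1) → Fin (d + 1)) i = c := by
  simp

/-- Values at the other slots. -/
theorem emb_apply_succAbove (i a c : Fin (d + 1)) (v : Fin d → Fin d) (k : Fin d) :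
    (i.insertNth c (fun k => a.succAbove (v k)) : Fin (d + 1) → Fin (d + 1)) (i.succAbove k) =
      a.succAbove (v k) := by
  simp

/-- Changing the free letter is an update at the contracted slot. -/
theorem emb_eq_update (i a c : Fin (d + 1)) (v : Fin d → Fin d) :
    (i.insertNth c (fun k => a.succAbove (v k)) : Fin (d + 1) → Fin (d + 1)) =
      Function.update (i.insertNth a (fun k => a.succAbove (v k))) i c := by
  funext j
  rcases Fin.eq_self_or_eq_succAbove i j with rfl | ⟨k, rfl⟩
  · rw [emb_apply_same, Function.update_self]
  · rw [emb_apply_succAbove, Function.update_of_ne (Fin.succAbove_ne _ _), emb_apply_succAbove]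

/-- Injectivity: the embedded assignment with free letter `c` is injective iff the small one is AND `c = a`. -/
theorem emb_injective_iff (i a c : Fin (d + 1)) (v : Fin d → Fin d) :
    Function.Injective (i.insertNth c (fun k => a.succAbove (v k)) : Fin (d + 1) → Fin (d + 1)) ↔
      Function.Injective v ∧ c = a := by
  constructor
  · intro h
    have hv : Function.Injective v := by
      intro k k' hkk'
      have h1 : (i.insertNth c (fun k => a.succAbove (v k)) : Fin (d + 1) → Fin (d + 1)) (i.succAbove k) =
          (i.insertNth c (fun k => a.succAbove (v k)) : Fin (d + 1) → Fin (d + 1)) (i.succAbove k') := by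
        rw [emb_apply_succAbove, emb_apply_succAbove, hkk']
      exact Fin.succAbove_right_injective (h h1)
    refine ⟨hv, ?_⟩
    by_contra hca
    obtain ⟨c', rfl⟩ := Fin.exists_succAbove_eq hca
    -- `v` is a bijection, so `c'` is a value of `v`
    obtain ⟨k, hk⟩ := (Finite.injective_iff_bijective.mp hv).2 c'
    have h1 : (i.insertNth (a.succAbove c') (fun k => a.succAbove (v k)) : Fin (d + 1) → Fin (d + 1))
        (i.succAbove k) = (i.insertNth (a.succAbove c') (fun k => a.succAbove (v k)) : Fin (d + 1) → Fin (d + 1)) i := by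
      rw [emb_apply_succAbove, emb_apply_same, hk]
    exact Fin.succAbove_ne i k (h h1)
  · rintro ⟨hv, rfl⟩
    exact (LaplaceRestrict.ext_injective_iff i c v).mpr hv

/-- The contracted pattern: `Σ_c λ_c [v[i ↦ c] injective] = λ_a [v' injective]` on the sub-box of letters `≠ a`. -/
theorem sum_pattern (i a : Fin (d + 1)) (lam : Fin (d + 1) → ℂ) (v : Fin d → Fin d) :
    (∑ c, lam c * (if Function.Injective (i.insertNth c (fun k => a.succAbove (v k)) : Fin (d + 1) → Fin (d + 1))
        then (1 : ℂ) else 0)) = lam a * (if Function.Injective v then 1 else 0) := by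
  by_cases hv : Function.Injective v
  · rw [if_pos hv, Finset.sum_eq_single a]
    · rw [if_pos ((emb_injective_iff i a a v).mpr ⟨hv, rfl⟩)]
    · intro c _ hca
      rw [if_neg (fun h => hca ((emb_injective_iff i a c v).mp h).2), mul_zero]
    · intro h; exact absurd (mem_univ a) h
  · rw [if_neg hv, mul_zero]
    refine sum_eq_zero fun c _ => ?_
    rw [if_neg (fun h => hv ((emb_injective_iff i a c v).mp h).1), mul_zero]

/-! ### §2 Contraction of a decomposition -/

/-- **Contraction.**  `LaplaceOptimal d` bounds what survives the contraction of slot `i` against a covector `lam` with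
`lam a ≠ 0`: if the terms in `K ⊆ T` are KILLED by `lam` at slot `i` (a `u`-factor with `i ∈ S_t` and
`Σ_c lam_c u_t(v[i ↦ c]) = 0` for all `v`, or a `w`-factor with `i ∉ S_t` likewise), then
`d! ≤ Σ_{t ∈ T \ K} c_t! (d - c_t)!` with `c_t = |{k : i.succAbove k ∈ S_t}|`. -/
theorem contract (hL : LaplaceOptimal d) {N : ℕ} (T : Finset (Fin N)) (S : Fin N → Finset (Fin (d + 1)))
    (u w : Fin N → (Fin (d + 1) → Fin (d + 1)) → ℂ)
    (hu : ∀ t, ∀ v v' : Fin (d + 1) → Fin (d + 1), (∀ j ∈ S t, v j = v' j) → u t v = u t v')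
    (hw : ∀ t, ∀ v v' : Fin (d + 1) → Fin (d + 1), (∀ j, j ∉ S t → v j = v' j) → w t v = w t v')
    (hsum : ∀ v : Fin (d + 1) → Fin (d + 1), (∑ t ∈ T, u t v * w t v) = if Function.Injective v then 1 else 0)
    (i a : Fin (d + 1)) (lam : Fin (d + 1) → ℂ) (ha : lam a ≠ 0) (K : Finset (Fin N)) (hKT : K ⊆ T)
    (hK : ∀ t ∈ K, (i ∈ S t ∧ ∀ v : Fin (d + 1) → Fin (d + 1), ∑ c, lam c * u t (Function.update v i c) = 0) ∨
      (i ∉ S t ∧ ∀ v : Fin (d + 1) → Fin (d + 1), ∑ c, lam c * w t (Function.update v i c) = 0)) :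
    d.factorial ≤ ∑ t ∈ T \ K, (univ.filter (fun k : Fin d => i.succAbove k ∈ S t)).card.factorial *
      (d - (univ.filter (fun k : Fin d => i.succAbove k ∈ S t)).card).factorial := by
  classical
  -- the embedding with free letter `c`
  set E : Fin (d + 1) → (Fin d → Fin d) → (Fin (d + 1) → Fin (d + 1)) :=
    fun c v' => i.insertNth c (fun k => a.succAbove (v' k)) with hE
  -- agreement of two embeddings on / off the split
  have hEu : ∀ t c, ∀ v v' : Fin d → Fin d,
      (∀ k ∈ univ.filter (fun k : Fin d => i.succAbove k ∈ S t), v k = v' k) → u t (E c v) = u t (E c v') := by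
    intro t c v v' hvv'
    refine hu t _ _ (fun j hj => ?_)
    rcases Fin.eq_self_or_eq_succAbove i j with rfl | ⟨k, rfl⟩
    · simp only [hE]; rw [emb_apply_same, emb_apply_same]
    · have hk : k ∈ univ.filter (fun k : Fin d => i.succAbove k ∈ S t) := by simpa using hj
      simp only [hE]; rw [emb_apply_succAbove, emb_apply_succAbove, hvv' k hk]
  have hEw : ∀ t c, ∀ v v' : Fin d → Fin d,
      (∀ k, k ∉ univ.filter (fun k : Fin d => i.succAbove k ∈ S t) → v k = v' k) → w t (E c v) = w t (E c v') := by
    intro t c v v' hvv'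
    refine hw t _ _ (fun j hj => ?_)
    rcases Fin.eq_self_or_eq_succAbove i j with rfl | ⟨k, rfl⟩
    · simp only [hE]; rw [emb_apply_same, emb_apply_same]
    · have hk : k ∉ univ.filter (fun k : Fin d => i.succAbove k ∈ S t) := by simpa using hj
      simp only [hE]; rw [emb_apply_succAbove, emb_apply_succAbove, hvv' k hk]
  -- changing the free letter does not affect a factor blind to slot `i`
  have hwc : ∀ t c v, i ∈ S t → w t (E c v) = w t (E a v) := by
    intro t c v hi
    refine hw t _ _ (fun j hj => ?_)
    have hji : j ≠ i := fun h => hj (h ▸ hi)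
    simp only [hE]; rw [emb_eq_update i a c, Function.update_of_ne hji]
  have huc : ∀ t c v, i ∉ S t → u t (E c v) = u t (E a v) := by
    intro t c v hi
    refine hu t _ _ (fun j hj => ?_)
    have hji : j ≠ i := fun h => hi (h ▸ hj)
    simp only [hE]; rw [emb_eq_update i a c, Function.update_of_ne hji]
  -- the contracted decomposition of `P_d`
  refine hL N (T \ K) (fun t => univ.filter (fun k : Fin d => i.succAbove k ∈ S t))
    (fun t v => if i ∈ S t then (lam a)⁻¹ * ∑ c, lam c * u t (E c v) else u t (E a v))
    (fun t v => if i ∈ S t then w t (E a v) else (lam a)⁻¹ * ∑ c, lam c * w t (E c v)) ?_ ?_ ?_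
  · -- `u'` locality
    intro t v v' hvv'
    by_cases hi : i ∈ S t
    · simp only [if_pos hi]
      congr 1
      exact sum_congr rfl fun c _ => by rw [hEu t c v v' hvv']
    · simp only [if_neg hi]; exact hEu t a v v' hvv'
  · -- `w'` locality
    intro t v v' hvv'
    by_cases hi : i ∈ S t
    · simp only [if_pos hi]; exact hEw t a v v' hvv'
    · simp only [if_neg hi]
      congr 1
      exact sum_congr rfl fun c _ => by rw [hEw t c v v' hvv']
  · -- the identity
    intro v
    -- each surviving term contracts to `(lam a)⁻¹ Σ_c lam_c u_t(E c v) w_t(E c v)`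
    have hterm : ∀ t, (if i ∈ S t then (lam a)⁻¹ * ∑ c, lam c * u t (E c v) else u t (E a v)) *
        (if i ∈ S t then w t (E a v) else (lam a)⁻¹ * ∑ c, lam c * w t (E c v)) =
        (lam a)⁻¹ * ∑ c, lam c * (u t (E c v) * w t (E c v)) := by
      intro t
      by_cases hi : i ∈ S t
      · simp only [if_pos hi]
        rw [mul_assoc, sum_mul]
        congr 1
        exact sum_congr rfl fun c _ => by rw [hwc t c v hi]; ring
      · simp only [if_neg hi]
        rw [mul_left_comm, mul_sum]
        congr 1
        exact sum_congr rfl fun c _ => by rw [huc t c v hi]; ring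
    simp only [hterm]
    rw [← mul_sum, sum_comm]
    -- the killed terms contribute nothing
    have hkill : ∀ c, ∑ t ∈ T \ K, lam c * (u t (E c v) * w t (E c v)) =
        ∑ t ∈ T, lam c * (u t (E c v) * w t (E c v)) - ∑ t ∈ K, lam c * (u t (E c v) * w t (E c v)) := by
      intro c
      rw [← sum_sdiff hKT]; ring
    have hK0 : ∑ c, ∑ t ∈ K, lam c * (u t (E c v) * w t (E c v)) = 0 := by
      rw [sum_comm]
      refine sum_eq_zero fun t ht => ?_
      rcases hK t ht with ⟨hi, hz⟩ | ⟨hi, hz⟩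
      · have : ∑ c, lam c * (u t (E c v) * w t (E c v)) = (∑ c, lam c * u t (E c v)) * w t (E a v) := by
          rw [sum_mul]; exact sum_congr rfl fun c _ => by rw [hwc t c v hi]; ring
        rw [this]
        have hz' := hz (E a v)
        have hupd : ∀ c, Function.update (E a v) i c = E c v := fun c => by
          simp only [hE]; rw [← emb_eq_update i a c]
        simp only [hupd] at hz'
        rw [hz', zero_mul]
      · have : ∑ c, lam c * (u t (E c v) * w t (E c v)) = u t (E a v) * ∑ c, lam c * w t (E c v) := by
          rw [mul_sum]; exact sum_congr rfl fun c _ => by rw [huc t c v hi]; ring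
        rw [this]
        have hz' := hz (E a v)
        have hupd : ∀ c, Function.update (E a v) i c = E c v := fun c => by
          simp only [hE]; rw [← emb_eq_update i a c]
        simp only [hupd] at hz'
        rw [hz', mul_zero]
    have htot : ∑ c, ∑ t ∈ T \ K, lam c * (u t (E c v) * w t (E c v)) =
        ∑ c, lam c * (if Function.Injective (E c v) then (1 : ℂ) else 0) := by
      simp only [hkill, sum_sub_distrib, hK0, sub_zero]
      refine sum_congr rfl fun c _ => ?_
      rw [← mul_sum, hsum]
    rw [htot]
    simp only [hE]
    rw [sum_pattern i a lam v, ← mul_assoc, inv_mul_cancel₀ ha, one_mul]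

/-! ### §3 The normal-form corollary at `d + 1 = 5` -/

/-- **Contraction count at `d + 1 = 5`.**  Slices `α_k(v_{i k}) · W_k(v)` and pair terms `u_t(v_{p t}, v_{q t}) · w_t(v)`
summing to the `5 × 5` permutation pattern; a slot `s` with fewer than five slices.  Then (by `laplaceOptimal_four`
applied to the contraction of slot `s` against a covector orthogonal to the slice vectors at `s`)
`24 ≤ 6·#{k : i k ≠ s} + 6·#{t : s ∈ {p t, q t}} + 4·#{t : s ∉ {p t, q t}}`. -/
theorem contract_five {Ns Np : ℕ}
    (i : Fin Ns → Fin 5) (α : Fin Ns → Fin 5 → ℂ) (W : Fin Ns → (Fin 5 → Fin 5) → ℂ)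
    (hW : ∀ k, ∀ v v' : Fin 5 → Fin 5, (∀ j, j ≠ i k → v j = v' j) → W k v = W k v')
    (p q : Fin Np → Fin 5) (hpq : ∀ t, p t ≠ q t) (u w : Fin Np → (Fin 5 → Fin 5) → ℂ)
    (hu : ∀ t, ∀ v v' : Fin 5 → Fin 5, v (p t) = v' (p t) → v (q t) = v' (q t) → u t v = u t v')
    (hw : ∀ t, ∀ v v' : Fin 5 → Fin 5, (∀ j, j ≠ p t → j ≠ q t → v j = v' j) → w t v = w t v')
    (H : ∀ v : Fin 5 → Fin 5,
      (if Function.Injective v then (1 : ℂ) else 0) = (∑ k, α k (v (i k)) * W k v) + ∑ t, u t v * w t v)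
    (s : Fin 5) (hs : (univ.filter (fun k => i k = s)).card < 5) :
    24 ≤ 6 * (univ.filter (fun k => i k ≠ s)).card + 6 * (univ.filter (fun t => p t = s ∨ q t = s)).card +
      4 * (univ.filter (fun t => p t ≠ s ∧ q t ≠ s)).card := by
  classical
  -- a covector orthogonal to the slice vectors at `s`, and a letter where it does not vanish
  obtain ⟨lam, hlam0, hlam⟩ := LaplaceTriangular.exists_ne_zero_orthogonal
    ((univ.filter (fun k => i k = s)).image α) (lt_of_le_of_lt card_image_le hs)
  obtain ⟨a, ha⟩ : ∃ a, lam a ≠ 0 := by by_contra h; push Not at h; exact hlam0 (funext h)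
  -- the decomposition in the official data format
  let Sset : Fin (Ns + Np) → Finset (Fin 5) := Fin.addCases (fun k => ({i k} : Finset (Fin 5))) (fun t => {p t, q t})
  let U : Fin (Ns + Np) → (Fin 5 → Fin 5) → ℂ := Fin.addCases (fun k v => α k (v (i k))) (fun t => u t)
  let V : Fin (Ns + Np) → (Fin 5 → Fin 5) → ℂ := Fin.addCases W (fun t => w t)
  have hS1 : ∀ k, Sset (Fin.castAdd Np k) = {i k} := fun k => by simp [Sset]
  have hS2 : ∀ t, Sset (Fin.natAdd Ns t) = {p t, q t} := fun t => by simp [Sset]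
  have hU1 : ∀ k, U (Fin.castAdd Np k) = fun v => α k (v (i k)) := fun k => by simp [U]
  have hU2 : ∀ t, U (Fin.natAdd Ns t) = u t := fun t => by simp [U]
  have hV1 : ∀ k, V (Fin.castAdd Np k) = W k := fun k => by simp [V]
  have hV2 : ∀ t, V (Fin.natAdd Ns t) = w t := fun t => by simp [V]
  have hUloc : ∀ x, ∀ v v' : Fin 5 → Fin 5, (∀ j ∈ Sset x, v j = v' j) → U x v = U x v' := by
    intro x v v' hvv'
    induction x using Fin.addCases with
    | left k =>
      rw [hU1]
      have := hvv' (i k) (by rw [hS1]; simp)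
      simp [this]
    | right t =>
      rw [hU2]
      exact hu t v v' (hvv' (p t) (by rw [hS2]; simp)) (hvv' (q t) (by rw [hS2]; simp))
  have hVloc : ∀ x, ∀ v v' : Fin 5 → Fin 5, (∀ j, j ∉ Sset x → v j = v' j) → V x v = V x v' := by
    intro x v v' hvv'
    induction x using Fin.addCases with
    | left k =>
      rw [hV1]
      exact hW k v v' (fun j hj => hvv' j (by rw [hS1]; simpa using hj))
    | right t =>
      rw [hV2]
      exact hw t v v' (fun j hjp hjq => hvv' j (by rw [hS2]; simp [hjp, hjq]))
  have hsum : ∀ v : Fin 5 → Fin 5, (∑ x ∈ (univ : Finset (Fin (Ns + Np))), U x v * V x v) =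
      if Function.Injective v then 1 else 0 := by
    intro v
    rw [Fin.sum_univ_add]
    simp only [hU1, hU2, hV1, hV2]
    exact (H v).symm
  -- the killed terms: the slices at `s`
  let K : Finset (Fin (Ns + Np)) := (univ.filter (fun k => i k = s)).image (Fin.castAdd Np)
  have hKmem : ∀ x, x ∈ K ↔ ∃ k, i k = s ∧ Fin.castAdd Np k = x := fun x => by simp [K]
  have hK : ∀ x ∈ K, (s ∈ Sset x ∧ ∀ v : Fin 5 → Fin 5, ∑ c, lam c * U x (Function.update v s c) = 0) ∨
      (s ∉ Sset x ∧ ∀ v : Fin 5 → Fin 5, ∑ c, lam c * V x (Function.update v s c) = 0) := by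
    intro x hx
    obtain ⟨k, hk, rfl⟩ := (hKmem x).mp hx
    left
    refine ⟨by rw [hS1, ← hk]; exact mem_singleton_self _, fun v => ?_⟩
    rw [hU1]
    have := hlam (α k) (mem_image.mpr ⟨k, by simp [hk], rfl⟩)
    simpa [← hk] using this
  have hb := LaplaceContract.contract (d := 4) laplaceOptimal_four univ Sset U V hUloc hVloc hsum s a lam ha K
    (subset_univ _) hK
  -- evaluate the weights of the surviving terms
  have hcS : ∀ k, (univ.filter (fun k' : Fin 4 => s.succAbove k' ∈ Sset (Fin.castAdd Np k))).card =
      if i k = s then 0 else 1 := by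
    intro k
    have h := LaplaceRestrict.card_eq s (Sset (Fin.castAdd Np k))
    rw [hS1, card_singleton] at h
    rw [hS1]
    by_cases hik : i k = s
    · rw [if_pos hik]; rw [if_pos (mem_singleton.mpr hik.symm)] at h; omega
    · rw [if_neg hik]; rw [if_neg (fun e => hik (mem_singleton.mp e).symm)] at h; omega
  have hcP : ∀ t, (univ.filter (fun k' : Fin 4 => s.succAbove k' ∈ Sset (Fin.natAdd Ns t))).card =
      if p t = s ∨ q t = s then 1 else 2 := by
    intro t
    have h := LaplaceRestrict.card_eq s (Sset (Fin.natAdd Ns t))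
    rw [hS2, card_pair (hpq t)] at h
    rw [hS2]
    by_cases hst : p t = s ∨ q t = s
    · rw [if_pos hst]
      have hmem : s ∈ ({p t, q t} : Finset (Fin 5)) := by
        rw [mem_insert, mem_singleton]; rcases hst with e | e
        · exact Or.inl e.symm
        · exact Or.inr e.symm
      rw [if_pos hmem] at h; omega
    · rw [if_neg hst]
      have hmem : s ∉ ({p t, q t} : Finset (Fin 5)) := by
        rw [mem_insert, mem_singleton]; push Not at hst ⊢; exact ⟨fun e => hst.1 e.symm, fun e => hst.2 e.symm⟩
      rw [if_neg hmem] at h; omega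
  -- the sum over the surviving terms
  set f : Fin (Ns + Np) → ℕ := fun x => (univ.filter (fun k' : Fin 4 => s.succAbove k' ∈ Sset x)).card.factorial *
    (4 - (univ.filter (fun k' : Fin 4 => s.succAbove k' ∈ Sset x)).card).factorial with hf
  have hfS : ∀ k, i k ≠ s → f (Fin.castAdd Np k) = 6 := fun k hk => by
    simp only [hf]; rw [hcS k, if_neg hk]; decide
  have hfP : ∀ t, f (Fin.natAdd Ns t) = if p t = s ∨ q t = s then 6 else 4 := fun t => by
    simp only [hf]; rw [hcP t]
    by_cases hst : p t = s ∨ q t = s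
    · rw [if_pos hst, if_pos hst]; decide
    · rw [if_neg hst, if_neg hst]; decide
  have hnotK : ∀ t, Fin.natAdd Ns t ∉ K := by
    intro t ht
    obtain ⟨k, -, hk⟩ := (hKmem _).mp ht
    have := congrArg Fin.val hk
    simp at this
    omega
  have hKS : ∀ k, Fin.castAdd Np k ∈ K ↔ i k = s := by
    intro k
    rw [hKmem]
    constructor
    · rintro ⟨k', hk', e⟩
      rw [← Fin.castAdd_inj.mp e]; exact hk'
    · intro h; exact ⟨k, h, rfl⟩
  have hsplit : ∑ x ∈ univ \ K, f x =
      6 * (univ.filter (fun k => i k ≠ s)).card + (6 * (univ.filter (fun t => p t = s ∨ q t = s)).card +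
        4 * (univ.filter (fun t => p t ≠ s ∧ q t ≠ s)).card) := by
    have h1 : ∑ x ∈ univ \ K, f x = ∑ x, (if x ∈ univ \ K then f x else 0) := by
      rw [sum_ite_mem, univ_inter]
    rw [h1, Fin.sum_univ_add]
    congr 1
    · have : ∀ k, (if Fin.castAdd Np k ∈ univ \ K then f (Fin.castAdd Np k) else 0) = if i k ≠ s then 6 else 0 := by
        intro k
        by_cases hk : i k = s
        · rw [if_neg (by simp [hKS, hk]), if_neg (by simp [hk])]
        · rw [if_pos (by simp [hKS, hk]), if_pos hk, hfS k hk]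
      simp only [this]
      rw [← sum_filter, sum_const, smul_eq_mul, mul_comm]
    · have : ∀ t, (if Fin.natAdd Ns t ∈ univ \ K then f (Fin.natAdd Ns t) else 0) =
          (if p t = s ∨ q t = s then 6 else 0) + (if p t ≠ s ∧ q t ≠ s then 4 else 0) := by
        intro t
        rw [if_pos (by simp [hnotK t]), hfP t]
        by_cases hst : p t = s ∨ q t = s
        · rw [if_pos hst, if_pos hst, if_neg (fun h => hst.elim h.1 h.2)]
        · rw [if_neg hst, if_neg hst, if_pos (not_or.mp hst)]
      simp only [this]
      rw [sum_add_distrib, ← sum_filter, ← sum_filter, sum_const, sum_const, smul_eq_mul, smul_eq_mul, mul_comm,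
        mul_comm (univ.filter (fun t => p t ≠ s ∧ q t ≠ s)).card]
  have h24 : (4 : ℕ).factorial = 24 := rfl
  rw [h24, hsplit] at hb
  omega

/-- **Contraction kills a labelled configuration violating the count.**  Same data; if for some slot `s` with fewer than
five slices `6·#{k : i k ≠ s} + 6·#{t : s ∈ {p t, q t}} + 4·#{t : s ∉ {p t, q t}} < 24`, the decomposition identity is
impossible. -/
theorem three_slices_contract {Ns Np : ℕ}
    (i : Fin Ns → Fin 5) (α : Fin Ns → Fin 5 → ℂ) (W : Fin Ns → (Fin 5 → Fin 5) → ℂ)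
    (hW : ∀ k, ∀ v v' : Fin 5 → Fin 5, (∀ j, j ≠ i k → v j = v' j) → W k v = W k v')
    (p q : Fin Np → Fin 5) (hpq : ∀ t, p t ≠ q t) (u w : Fin Np → (Fin 5 → Fin 5) → ℂ)
    (hu : ∀ t, ∀ v v' : Fin 5 → Fin 5, v (p t) = v' (p t) → v (q t) = v' (q t) → u t v = u t v')
    (hw : ∀ t, ∀ v v' : Fin 5 → Fin 5, (∀ j, j ≠ p t → j ≠ q t → v j = v' j) → w t v = w t v')
    (s : Fin 5) (hs : (univ.filter (fun k => i k = s)).card < 5)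
    (hlt : 6 * (univ.filter (fun k => i k ≠ s)).card + 6 * (univ.filter (fun t => p t = s ∨ q t = s)).card +
      4 * (univ.filter (fun t => p t ≠ s ∧ q t ≠ s)).card < 24) :
    ¬ ∀ v : Fin 5 → Fin 5,
      (if Function.Injective v then (1 : ℂ) else 0) = (∑ k, α k (v (i k)) * W k v) + ∑ t, u t v * w t v :=
  fun H => absurd (contract_five i α W hW p q hpq u w hu hw H s hs) (not_le.mpr hlt)

end LaplaceContract

end Summit.ValiantsHypothesis.ValiantsHypothesis.Theorems.RigidityForcesSymmetryRankRigidMinimalRepr
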